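import Summits.NavierStokesRegularity.FunctionalMining.NoGo.StrainMomentHeatCoerciveLtTwo
import Summits.NavierStokesRegularity.FunctionalMining.NoGo.TopBotEigHeatCoerciveSplit
import HarnessLib

/-!
# FunctionalMining / NoGo — K12: door D-K6 (c) BELOW `q = 2` reduced to the finite-dimensional
# splitting — `TopBotEigSplitting q c → 0 < c → TopBotEigHeatCoercivePos q` for real `1 < q < 2`

HONEST FRAMING. Search for candidate a priori estimates; no regularity claim. Nothing about
Navier–Stokes is proved or asserted in this file: inequalities for smooth vector fields on the
flat torus along the HEAT line `v + tΔv` (no transport term, no pressure) and lemmas of real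
analysis. Cell `pub-nsfunc`, no-go seat (gen 39). K11 = FOUR files, imported in this order: K11a
`NoGo/StrainMomentLtTwoRadial` → K11b `NoGo/StrainMomentLtTwoLine` → K11c `NoGo/StrainMomentLtTwoReg`
→ K11d `NoGo/StrainMomentHeatCoerciveLtTwo` (the row); K12 = `NoGo/TopBotEigHeatCoerciveLtTwo`.

THE TARGET (K11d). The tree proves the heat row of the strain moment `Z_q = torusStrainMoment q =
∫|S|^q` — `TopEig.HeatCoercive Z_q c`: `c·Z_q(v) ≤ heatDissipation Z_q v = −(d/dt)⁺Z_q(v+tΔv)|₀` on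
smooth divergence-free `v` — for real `q > 2` (`TopEigStrainHeatLine`, through the weighted
dissipation `D_Z = ∫|S|^{q−2}|∇S|²` and `npConst q`) and at `q = 2` (K7/K8). BELOW `q = 2` the weight
`|S|^{q−2}` is singular on `{S = 0}` and no `D_Z` is available; K11 proves the row for EVERY REAL
`1 < q < 2` without ever forming a weighted dissipation at `ε = 0`:
`TopEig.strainMoment_heatCoercive_of_lt_two (hq1 : 1 < q) (hq2 : q < 2) : HeatCoercive Z_q (c_Z q)`,
`c_Z q = TopEig.zqRateLtTwo q = 2π²q(q−1)/(51(2−q/2)²)` (not sharp), in FIELD FORM (every smooth `v`).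
K12 re-runs K9's mixture principle with this row: `TopBotEigSplitting q c → 0 < c →
TopBotEigHeatCoercivePos q` for `1 < q < 2` (door D-K6 (c) below `q = 2` REDUCED to the splitting, which
is NOT proved below `q = 2`).

WHAT IS PROVED HERE [ours], on `T³`, for real `1 < q < 2` — K9's §2–§4 re-run with the K11d row in place
of the `q > 2` row (K9's `TopBotEigSplitting`, `topBotEigMoment_eq_of_splitting`,
`topBotEigMoment_le_two_mul_strainMoment` and the tree's `heatDissipation_nonneg_of_admissible`,
`convexOn_integral_posPart_rpow_line`, `convexOn_strainMoment_line` carry no hypothesis `q > 2`):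
* **`TopEig.admissibleMix_heatDissipation_ge_of_lt_two`**: `g` convex, `1`-Lipschitz, `≥ 0` on
  divergence-free strains, `M, c ≥ 0`, `Φ = M∫g(S)^q + c·Z_q` on smooth divergence-free fields ⟹
  `c·(c_Z(q)·Z_q(v)) ≤ heatDissipation Φ v`;
* **`TopEig.topBotEigMoment_heatDissipation_ge_of_splitting_of_lt_two`**,
  **`TopEig.topBotEigMoment_heatCoercive_of_splitting_of_lt_two (hq1 : 1 < q) (hq2 : q < 2) (hc : 0 ≤ c) :
  TopBotEigSplitting q c → HeatCoercive (topBotEigMoment q) (c·c_Z(q)/2)`**, and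
  **`TopEig.topBotEigHeatCoercivePos_of_splitting_of_lt_two (hq1 : 1 < q) (hq2 : q < 2) (hc : 0 < c)
  (hS : TopBotEigSplitting q c) : TopBotEigHeatCoercivePos (d := Fin 3) q`**.

WHAT IS NOT PROVED HERE. `∃ c > 0, TopBotEigSplitting q c` for `1 < q < 2`: K10's second-difference floor
uses `2 ≤ q`, and below `2` the splitting is OPEN (a Rayleigh-type route is a pen note of the no-go seat,
not a theorem); door D-K6 (b) (`3/2 < q < 2`) is untouched and OPEN both ways.

PROVENANCE / STATUS. Typed and farm-checked by the no-go seat (gen 39): K11a stand-alone, the others as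
concatenations with the union of their tree imports (evidence `pub-nsfunc-nogo/sieveld/kth/`: check
JSONs, a negative control, the by-value file `zqRateLtTwo (3/2) = 8π²/425`). STATUS: STAGED
(`pub-nsfunc-nogo/NoGo/<name>.STAGING.lean`); filing by a prove seat on the lead's word in the order
K11a → K11b → K11c → K11d → K12, after K8 `NoGo/TopBotEigHeatCoerciveTwoSharp` and K9
`NoGo/TopBotEigHeatCoerciveSplit` (both in the tree); the planner seat cannot file under
`FunctionalMining/`. No constant is claimed sharp. Search for candidate a priori estimates; no
regularity claim. [ours; K1-Q6 = door D-K6, heat side, `1 < q < 2`]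
FILING (prove seat g26, REQUEST #25e): declarations byte-identical to the no-go seat's staged `TopBotEigHeatCoerciveLtTwo.STAGING.lean` 0b8c5a23760e4173; this line is the only addition.
-/

noncomputable section

open MeasureTheory Finset Set Filter Topology
open scoped InnerProductSpace RealInnerProductSpace ContDiff Real

namespace Summit.NavierStokesRegularity.FunctionalMining

open Literature.Analysis.FunctionSpaces Literature.Analysis.FunctionSpaces.Torus
  Literature.Analysis.FluidPDE

namespace TopEig

open StrainL4 StrainMoment

/-! ## 9. Door D-K6 (c) below `q = 2`: the symmetrised core from the splitting, `1 < q < 2` -/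

/-- **The mixture principle below `q = 2`.** For real `1 < q < 2`, `g` convex, `1`-Lipschitz and
non-negative on divergence-free strains, `M, c ≥ 0`, any `Φ` equal to `M ∫ g(S)^q + c Z_q` on smooth
divergence-free fields, and every smooth divergence-free `v` on `T³`:
`c · c_Z(q) · Z_q(v) ≤ heatDissipation Φ v` (the `q > 2` statement `admissibleMix_heatDissipation_ge`
has `c q D_Z` on the left; below `q = 2` the weighted dissipation `D_Z` is not used and the strain
share pays through the field-form row `strainLinePairing_laplacian_zero_le_of_lt_two`). [ours] -/
theorem admissibleMix_heatDissipation_ge_of_lt_two {q : ℝ} (hq1 : 1 < q) (hq2 : q < 2)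
    {g : EuclideanSpace ℝ (Fin 3 × Fin 3) → ℝ} (hconv : ConvexOn ℝ univ g)
    (hlip : LipschitzWith 1 g)
    (hg0 : ∀ v : UnitAddTorus (Fin 3) → EuclideanSpace ℝ (Fin 3), Torus.IsSmooth v →
      Torus.IsDivFree v → ∀ x, 0 ≤ g (strainFlat v x))
    {M c : ℝ} (hM : 0 ≤ M) (hc : 0 ≤ c)
    {Φ : (UnitAddTorus (Fin 3) → EuclideanSpace ℝ (Fin 3)) → ℝ}
    (hΦ : ∀ v : UnitAddTorus (Fin 3) → EuclideanSpace ℝ (Fin 3), Torus.IsSmooth v →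
      Torus.IsDivFree v → Φ v = M * (∫ x, g (strainFlat v x) ^ q) + c * torusStrainMoment q v)
    {v : UnitAddTorus (Fin 3) → EuclideanSpace ℝ (Fin 3)} (hv : Torus.IsSmooth v)
    (hdiv : Torus.IsDivFree v) :
    c * (zqRateLtTwo q * torusStrainMoment q v) ≤ heatDissipation Φ v := by
  have hq1' : (1 : ℝ) ≤ q := hq1.le
  have hΔ : Torus.IsSmooth (Torus.laplacian v) := hv.laplacian
  have hv1 : Torus.IsContDiff 1 v := hv.isContDiff (by simp)
  have hΔ1 : Torus.IsContDiff 1 (Torus.laplacian v) := hΔ.isContDiff (by simp)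
  have hline : ∀ t : ℝ, Torus.IsSmooth (v + t • Torus.laplacian v) ∧
      Torus.IsDivFree (v + t • Torus.laplacian v) := fun t =>
    ⟨isSmooth_heatLine hv t, isDivFree_add_smul hv hΔ hdiv (isDivFree_laplacian hv hdiv) t⟩
  -- the admissible part `H = ∫ g(S)^q`, as an opaque functional
  obtain ⟨H, hH⟩ : ∃ H : (UnitAddTorus (Fin 3) → EuclideanSpace ℝ (Fin 3)) → ℝ,
      ∀ w, H w = ∫ x, g (strainFlat w x) ^ q := ⟨_, fun _ => rfl⟩
  have hHcvx : ConvexOn ℝ univ (fun t : ℝ => H (v + t • Torus.laplacian v)) := by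
    have h := convexOn_integral_posPart_rpow_line (d := Fin 3) hconv hlip.continuous
      (continuous_strainFlat hv) (continuous_strainFlat hΔ) hq1'
    refine h.congr fun t _ => ?_
    show (∫ x, max (g (strainFlat v x + t • strainFlat (Torus.laplacian v) x)) 0 ^ q) =
      H (v + t • Torus.laplacian v)
    rw [hH]
    refine integral_congr_ae (ae_of_all _ fun x => ?_)
    show max (g (strainFlat v x + t • strainFlat (Torus.laplacian v) x)) 0 ^ q =
      g (strainFlat (v + t • Torus.laplacian v) x) ^ q
    rw [← strainFlat_add_smul hv1 hΔ1, max_eq_left (hg0 _ (hline t).1 (hline t).2 x)]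
  have hZcvx : ConvexOn ℝ univ (fun t : ℝ => torusStrainMoment q (v + t • Torus.laplacian v)) :=
    convexOn_strainMoment_line hq1' hv hΔ
  have hΦ0 : Φ v = M * H v + c * torusStrainMoment q v := by rw [hΦ v hv hdiv, hH]
  have hΦt : ∀ τ : ℝ, Φ (v + τ • Torus.laplacian v) = M * H (v + τ • Torus.laplacian v) +
      c * torusStrainMoment q (v + τ • Torus.laplacian v) := fun τ => by
    rw [hΦ _ (hline τ).1 (hline τ).2, hH]
  have hcvx : ConvexOn ℝ univ (fun t : ℝ => Φ (v + t • Torus.laplacian v)) := by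
    refine ((ConvexOn.smul hM hHcvx).add (ConvexOn.smul hc hZcvx)).congr fun t _ => ?_
    simp only [Pi.add_apply, smul_eq_mul]
    exact (hΦt t).symm
  -- `heatDissipation` is minus the right derivative, for `Φ` and for the admissible part
  obtain ⟨hder, heq⟩ := heatDissipation_eq_neg_rightDeriv (d := Fin 3) (Φ := Φ) (v := v) hcvx
  obtain ⟨hderH, heqH⟩ := heatDissipation_eq_neg_rightDeriv (d := Fin 3) (Φ := H) (v := v) hHcvx
  rw [heq]
  set D := derivWithin (fun t : ℝ => Φ (v + t • Torus.laplacian v)) (Set.Ioi 0) 0 with hD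
  set DH := derivWithin (fun t : ℝ => H (v + t • Torus.laplacian v)) (Set.Ioi 0) 0 with hDH
  have hDH0 : DH ≤ 0 := by
    have h0 : 0 ≤ heatDissipation H v :=
      heatDissipation_nonneg_of_admissible hq1' hconv hlip hg0 (Φ := H) (fun w _ _ => hH w) hv hdiv
    rw [heqH] at h0
    linarith
  have ht := (hasDerivWithinAt_iff_tendsto_slope' self_notMem_Ioi).mp hder
  have htH := (hasDerivWithinAt_iff_tendsto_slope' self_notMem_Ioi).mp hderH
  -- the slope of `Φ`, eventually, and its limit
  set ψ := strainLinePairing q v (Torus.laplacian v) with hψ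
  have hψc : Continuous ψ := continuous_strainLinePairing_of_one_lt hq1 hv hΔ
  have hev : ∀ᶠ τ in 𝓝[>] (0 : ℝ),
      slope (fun t : ℝ => Φ (v + t • Torus.laplacian v)) 0 τ ≤
      M * slope (fun t : ℝ => H (v + t • Torus.laplacian v)) 0 τ + c * ψ τ := by
    filter_upwards [self_mem_nhdsWithin] with τ (hτ : 0 < τ)
    have hZ : torusStrainMoment q (v + τ • Torus.laplacian v) - torusStrainMoment q v ≤ τ * ψ τ :=
      strainMoment_line_sub_le_of_one_lt hq1 hv hΔ τ
    rw [slope_def_field, slope_def_field, sub_zero]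
    simp only [zero_smul, add_zero]
    rw [hΦt τ, hΦ0, div_le_iff₀ hτ]
    calc M * H (v + τ • Torus.laplacian v) + c * torusStrainMoment q (v + τ • Torus.laplacian v) -
          (M * H v + c * torusStrainMoment q v)
        = M * (H (v + τ • Torus.laplacian v) - H v) +
          c * (torusStrainMoment q (v + τ • Torus.laplacian v) - torusStrainMoment q v) := by ring
      _ ≤ M * (H (v + τ • Torus.laplacian v) - H v) + c * (τ * ψ τ) :=
          add_le_add le_rfl (mul_le_mul_of_nonneg_left hZ hc)
      _ = (M * ((H (v + τ • Torus.laplacian v) - H v) / τ) + c * ψ τ) * τ := by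
          rw [add_mul, mul_assoc M, div_mul_cancel₀ _ hτ.ne']
          ring
  have hlim : Tendsto (fun τ : ℝ =>
      M * slope (fun t : ℝ => H (v + t • Torus.laplacian v)) 0 τ + c * ψ τ)
      (𝓝[>] (0 : ℝ)) (𝓝 (M * DH + c * ψ 0)) :=
    (htH.const_mul M).add (((hψc.tendsto 0).mono_left nhdsWithin_le_nhds).const_mul c)
  have hDle : D ≤ M * DH + c * ψ 0 := le_of_tendsto_of_tendsto ht hlim hev
  have hψ0 : ψ 0 ≤ -(zqRateLtTwo q * torusStrainMoment q v) :=
    strainLinePairing_laplacian_zero_le_of_lt_two hq1 hq2 hv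
  have ha : M * DH ≤ 0 := mul_nonpos_of_nonneg_of_nonpos hM hDH0
  have hb : c * ψ 0 ≤ c * (-(zqRateLtTwo q * torusStrainMoment q v)) :=
    mul_le_mul_of_nonneg_left hψ0 hc
  linarith

/-- **Under the splitting hypothesis, `heatDissipation (Φ_q + Ψ_q) v ≥ c · c_Z(q) · Z_q(v)`** for real
`1 < q < 2`, `c ≥ 0` and every smooth divergence-free `v` on `T³`. [ours] -/
theorem topBotEigMoment_heatDissipation_ge_of_splitting_of_lt_two {q c : ℝ} (hq1 : 1 < q)
    (hq2 : q < 2) (hc : 0 ≤ c) (hS : TopBotEigSplitting q c)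
    {v : UnitAddTorus (Fin 3) → EuclideanSpace ℝ (Fin 3)} (hv : Torus.IsSmooth v)
    (hdiv : Torus.IsDivFree v) :
    c * (zqRateLtTwo q * torusStrainMoment q v) ≤
      heatDissipation (topBotEigMoment (d := Fin 3) q) v := by
  obtain ⟨M, hM, h, hconv, hlip, hA⟩ := hS
  have hq0 : (0 : ℝ) < q := by linarith
  exact admissibleMix_heatDissipation_ge_of_lt_two hq1 hq2 hconv hlip
    (fun w hw hdw x => (hA _ (strainFlat_symm w x) (sum_diag_strainFlat_eq_zero hw hdw x)).1) hM hc
    (fun w hw hdw => topBotEigMoment_eq_of_splitting hq0 hlip.continuous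
      (fun A hs ht => (hA A hs ht).2) hw hdw) hv hdiv

/-- **Heat coercivity of `Φ_q + Ψ_q` from the splitting, below `q = 2`**: for real `1 < q < 2` and
`c ≥ 0`, `TopBotEigSplitting q c → HeatCoercive (Φ_q + Ψ_q) (c · c_Z(q) / 2)`. [ours] -/
theorem topBotEigMoment_heatCoercive_of_splitting_of_lt_two {q c : ℝ} (hq1 : 1 < q)
    (hq2 : q < 2) (hc : 0 ≤ c) (hS : TopBotEigSplitting q c) :
    HeatCoercive (d := Fin 3) (topBotEigMoment q) (c * zqRateLtTwo q / 2) := by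
  intro _ v hv hdiv _
  have hq0 : (0 : ℝ) < q := by linarith
  have hr0 : 0 < zqRateLtTwo q := zqRateLtTwo_pos hq1 (by linarith)
  have hdiss := topBotEigMoment_heatDissipation_ge_of_splitting_of_lt_two hq1 hq2 hc hS hv hdiv
  have h2 := topBotEigMoment_le_two_mul_strainMoment hq0 hv hdiv
  have hr : 0 ≤ c * zqRateLtTwo q / 2 := by positivity
  calc c * zqRateLtTwo q / 2 * topBotEigMoment q v
      ≤ c * zqRateLtTwo q / 2 * (2 * torusStrainMoment q v) := mul_le_mul_of_nonneg_left h2 hr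
    _ = c * (zqRateLtTwo q * torusStrainMoment q v) := by ring
    _ ≤ heatDissipation (topBotEigMoment q) v := hdiss

/-- **The kernel node of D-K6 (c) below `q = 2`, from the finite-dimensional obligation**: for real
`1 < q < 2`, `TopBotEigSplitting q c` with `c > 0` gives `TopBotEigHeatCoercivePos q` (witness rate
`c · c_Z(q) / 2`, `c_Z(q) = 2π² q (q−1) / (51 (2 − q/2)²)`). Search for candidate a priori estimates;
no regularity claim. [ours] -/
theorem topBotEigHeatCoercivePos_of_splitting_of_lt_two {q c : ℝ} (hq1 : 1 < q) (hq2 : q < 2)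
    (hc : 0 < c) (hS : TopBotEigSplitting q c) : TopBotEigHeatCoercivePos (d := Fin 3) q :=
  ⟨c * zqRateLtTwo q / 2, by have := zqRateLtTwo_pos hq1 (by linarith : q < 4); positivity,
    topBotEigMoment_heatCoercive_of_splitting_of_lt_two hq1 hq2 hc.le hS⟩

end TopEig

end Summit.NavierStokesRegularity.FunctionalMining
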